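import Summits.AtomisticToContinuum.Crystallization.Theorems.OverbindingBudgetEdgeRelaxationConverse
import Literature.Geometry.DiscreteGeometry.BondGraph

/-!
# OverbindingBudget — «ElasticSplit»: the edge-relaxation law RELAX cut by MECHANISM of relaxation (decomp-a2c lens-4, generation 27; statements)

Helper file (`--supports stmt-AtomisticToContinuum-31280`).  Route `OverbindingBudget` (Crystallization), crux `RobustDefectLimitWindows`
(stmt-AtomisticToContinuum-31280), registered line v8 «UniformCut» (frozen g26–g28).  Generation 26 («EdgeRelaxation») left the residual
RELAX = `EdgeRelaxationLaw T₀ D`: a texture of the recurrent clean class `CleanClass T₀ D` that is `(t, L)`-STRAINED (robust violators of the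
relaxed gapped-twelve test `L`-densely at every admissible scale) has STRAINED CUBES (`StrainedCubes κ`: cofinal cube chunks beaten by the finite
ground states by `κ ℓ³`).  RELAX says precisely: «no strained clean texture is an energy-density ground state».

THIS GENERATION cuts RELAX not by the geometric TYPE of the strain (g26, `edgeRelaxationLaw_iff_typed`) but by the MECHANISM that relaxes it —
the normal form of a minimal counterexample one level deeper.  A strained clean texture that NO competitor beats by a volume-order amount must
survive three TESTS, each a competitor family with the SAME particle number on the SAME cube:

* the DILATION TEST (§1; PROVED in `…ElasticSplitDilation`): dilating a chunk `F` by the optimal factor releases EXACTLY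
  `dilationGain F = (S₁₂ − S₆)² / (24 S₁₂)` (`S_k = ∑_{y,w ∈ F} dist⁻ᵏ`; Lennard-Jones is a quadratic polynomial in `λ⁻⁶` along dilations), so
  `E(#F) + dilationGain F ≤ U(F)` for EVERY finite chunk — the survivor is VIRIAL-BALANCED (`S₁₂ ≈ S₆` in density: zero pressure);
* the LOCAL TEST (§3; typed, TRUE-type): replacing finitely many atoms by as many others; by uniform recurrence an improvable patch recurs with
  bounded gaps and the simultaneous surgeries on a separated subfamily release `κ ℓ³` — the survivor is LOCALLY OPTIMAL (`LocallyOptimal`: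
  a count-preserving local ground state; in particular in exact force equilibrium);
* the CHARGE PRICE (§2/§4; roofed BY NAME by the shared crux `Theses.PricedLinkCensus.ChargedEnergyGap`, stmt-AtomisticToContinuum-14231, glue
  PROVED in `…ElasticSplitPricing`): cube chunks with `≥ ρ ℓ³` sites that are not charge-free at tolerance `1/100`
  (`Literature.Geometry.DiscreteGeometry.IsChargeFree`: twelve bonds in the scale-free bond graph, every bond with ring number four — the
  currency of route PricedLinkCensus) are beaten by `κ ρ ℓ³ − o(ℓ³)` — the survivor has SPARSE CHARGE (charged sites of upper density zero;
  in a uniformly recurrent texture: essentially none, every site is a `1 %`-perfect cuboctahedral / anticuboctahedral shell).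

What survives all three is the residual «ElasticLiouville» (§4, `ElasticLiouvilleLaw`): a clean, uniformly recurrent, locally optimal,
virial-balanced texture all of whose sites are (up to density zero) `1 %`-perfect Barlow shells is NOT strained at any `(t, L)` — a DISCRETE
NONLINEAR ELASTIC LIOUVILLE THEOREM (bounded-strain global equilibria of the lattice elastostatics, defect-free and stress-free, are homogeneous),
typed kernel-weaker than RELAX (same conclusion, three added hypotheses).  The split is exhaustive and every branch is RELAX restricted to a
subclass:

  `EdgeRelaxationLaw ⟸ ChargeDensityRelax ∧ SparseChargeRelax`            (`…Dilation.edgeRelaxationLaw_of_chargeSplit`, case split, PROVED)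
  `SparseChargeRelax ⟸ DilationTest ∧ LocalRelaxationTest ∧ ElasticLiouvilleLaw`   (`…Dilation.sparseChargeRelax_of_tests`, PROVED;
                                                                               DilationTest = `…Dilation.strainedCubes_of_dilationStrained`, PROVED)
  `ChargeDensityRelax ⟸ ChargedEnergyGap`                                   (`…Pricing.chargeDensityRelax_of_chargedEnergyGap`, PROVED)

so that `RobustDefectLimitWindows ⟸ GrossCleanBallsU (1/250) 10 ∧ ChargedEnergyGap ∧ LocalRelaxationTest (1/250) 10 ∧
ElasticLiouvilleLaw (1/250) 10 ∧ CleanlessExcessT ∧ CoherentResidual 10` (`…Pricing.rdef_of_grossU_elasticSplit_record`).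
-/

namespace Summit.AtomisticToContinuum.Crystallization.Theorems.OverbindingBudgetElasticSplitStatements

open Filter Metric Set Topology
open scoped BigOperators
open Literature.MathematicalPhysics.StatisticalMechanics
open Literature.Geometry.DiscreteGeometry (IsChargeFree)
open Summit.AtomisticToContinuum.Crystallization.Theorems.OverbindingBudgetRecurrentDustStatements (ViolatorsL)
open Summit.AtomisticToContinuum.Crystallization.Theorems.OverbindingBudgetEdgeRelaxationStatements
  (StrainedCubes CleanClass EdgeRelaxationLaw)

/-! ## §1  The dilation (virial) currency -/

/-- The inverse-power pair sum `S_k(F) = ∑_{y ∈ F} ∑_{w ∈ F} (dist y w)⁻¹ ^ k` of a finite chunk (the diagonal vanishes for `k ≥ 1`,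
`0⁻¹ = 0`).  For Lennard-Jones `V_LJ(r) = r⁻¹²/12 − r⁻⁶/6`:  `U(F) = ½ ∑∑ V_LJ = S₁₂/24 − S₆/12`. -/
noncomputable def invPowSum (k : ℕ) (F : Finset (EuclideanSpace ℝ (Fin 3))) : ℝ :=
  ∑ y ∈ F, ∑ w ∈ F, (dist y w)⁻¹ ^ k

/-- **The dilation gain** of a chunk: `(S₁₂ − S₆)² / (24 S₁₂)` — EXACTLY the energy released by the optimal homothety of the chunk
(`…ElasticSplitDilation.groundStateEnergy_add_dilationGain_le`: `E(#F) + dilationGain F ≤ U(F)`).  It vanishes iff the chunk is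
virial-balanced, `S₁₂ = S₆` (zero pressure: `∑ r V_LJ'(r) = −(S₁₂ − S₆) = 0`). -/
noncomputable def dilationGain (F : Finset (EuclideanSpace ℝ (Fin 3))) : ℝ :=
  (invPowSum 12 F - invPowSum 6 F) ^ 2 / (24 * invPowSum 12 F)

/-- `DilationStrainedCubes κ Y`: cofinally in `ℓ`, some cube chunk has dilation gain `≥ κ ℓ³` (its mean virial is off balance by a
volume-order amount).  Implies `StrainedCubes κ Y` (`…Dilation.strainedCubes_of_dilationStrained`). -/
def DilationStrainedCubes (κ : ℝ) (Y : Set (EuclideanSpace ℝ (Fin 3))) : Prop :=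
  ∀ ℓ₀ : ℝ, ∃ ℓ : ℝ, ℓ₀ ≤ ℓ ∧ ∃ c : EuclideanSpace ℝ (Fin 3), ∃ F : Finset (EuclideanSpace ℝ (Fin 3)),
    (↑F : Set (EuclideanSpace ℝ (Fin 3))) = Y ∩ {z | ∀ i : Fin 3, c i ≤ z i ∧ z i < c i + ℓ} ∧ κ * ℓ ^ 3 ≤ dilationGain F

/-- `VirialBalanced Y`: the texture passes the dilation test at every volume rate — no `κ > 0` has `DilationStrainedCubes κ Y`
(the dilation gain of all large cube chunks is `o(ℓ³)`, uniformly in the position). -/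
def VirialBalanced (Y : Set (EuclideanSpace ℝ (Fin 3))) : Prop :=
  ∀ κ : ℝ, 0 < κ → ¬ DilationStrainedCubes κ Y

/-! ## §2  The charge currency (route PricedLinkCensus) -/

/-- The number of sites of a finite configuration `y : Fin N → ℝ³` that are NOT charge-free at tolerance `1/100` — verbatim the count priced
by `Theses.PricedLinkCensus.ChargedEnergyGap` (stmt-AtomisticToContinuum-14231). -/
noncomputable def chargedCount {N : ℕ} (y : Fin N → EuclideanSpace ℝ (Fin 3)) : ℕ :=
  Nat.card {i : Fin N // ¬ IsChargeFree (1 / 100 : ℝ) y i}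

/-- `DenseCharge ρ Y`: cofinally in `ℓ`, some cube chunk of `Y`, injectively enumerated, has at least `ρ ℓ³` charged sites
(charge computed INSIDE the chunk, as `ChargedEnergyGap` prices it; boundary sites only add charge). -/
def DenseCharge (ρ : ℝ) (Y : Set (EuclideanSpace ℝ (Fin 3))) : Prop :=
  ∀ ℓ₀ : ℝ, ∃ ℓ : ℝ, ℓ₀ ≤ ℓ ∧ ∃ c : EuclideanSpace ℝ (Fin 3), ∃ N : ℕ, ∃ y : Fin N → EuclideanSpace ℝ (Fin 3),
    Function.Injective y ∧ Set.range y = Y ∩ {z | ∀ i : Fin 3, c i ≤ z i ∧ z i < c i + ℓ} ∧ ρ * ℓ ^ 3 ≤ (chargedCount y : ℝ)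

/-- `SparseCharge Y`: charged sites have uniform upper density zero — no `ρ > 0` has `DenseCharge ρ Y`. -/
def SparseCharge (Y : Set (EuclideanSpace ℝ (Fin 3))) : Prop :=
  ∀ ρ : ℝ, 0 < ρ → ¬ DenseCharge ρ Y

/-! ## §3  Count-preserving local optimality -/

/-- **Surgery gain.**  The energy released when the finite part `F` of the texture `Y` is replaced by the finite set `G` (to be used with
`↑F ⊆ Y`, `#G = #F`, `G` disjoint from `Y ∖ F`):  `[U(F) + I(F, Y ∖ F)] − [U(G) + I(G, Y ∖ F)]`, the fields `I(·, Y ∖ F)` being the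
(absolutely convergent, for uniformly discrete `Y`) sums `∑_{x} ∑'_{w ∈ Y ∖ F} V_LJ(dist x w)`. -/
noncomputable def surgeryGain (Y : Set (EuclideanSpace ℝ (Fin 3))) (F G : Finset (EuclideanSpace ℝ (Fin 3))) : ℝ :=
  (1 / 2 * ∑ y ∈ F, ∑ w ∈ F, lennardJones (dist y w) +
      ∑ y ∈ F, ∑' w : ↥(Y \ ↑F), lennardJones (dist y (w : EuclideanSpace ℝ (Fin 3)))) -
    (1 / 2 * ∑ y ∈ G, ∑ w ∈ G, lennardJones (dist y w) +
      ∑ y ∈ G, ∑' w : ↥(Y \ ↑F), lennardJones (dist y (w : EuclideanSpace ℝ (Fin 3))))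

/-- **`LocallyOptimal Y`** (count-preserving local ground state): no replacement of finitely many atoms of `Y` by as many new atoms (off the
rest of `Y`) releases energy.  Implies exact force equilibrium and local (compactly supported) stability; it is the `μ`-free companion of the
`μ`-ground-state tests of `Literature…MuGSC`. -/
def LocallyOptimal (Y : Set (EuclideanSpace ℝ (Fin 3))) : Prop :=
  ∀ F G : Finset (EuclideanSpace ℝ (Fin 3)), (↑F : Set (EuclideanSpace ℝ (Fin 3))) ⊆ Y → G.card = F.card →
    Disjoint (↑G : Set (EuclideanSpace ℝ (Fin 3))) (Y \ ↑F) → surgeryGain Y F G ≤ 0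

/-! ## §4  The pieces of the split -/

/-- **(A) `ChargeDensityRelax T₀ D`** — RELAX restricted to textures with DENSE CHARGE: a strained texture of the recurrent clean class one of
whose cube-chunk sequences carries `≥ ρ ℓ³` charged sites has strained cubes.  KERNEL-WEAKER than RELAX (added hypothesis); implied by
`ChargedEnergyGap` (`…ElasticSplitPricing.chargeDensityRelax_of_chargedEnergyGap`, which uses neither the strain nor the cleanliness). -/
def ChargeDensityRelax (T₀ D : ℝ) : Prop :=
  ∀ Y : Set (EuclideanSpace ℝ (Fin 3)), CleanClass T₀ D Y → ∀ t : ℝ, 0 < t → ∀ L : ℝ,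
    (∀ a' : ℝ, 47 / 50 ≤ a' → a' ≤ 1 → ViolatorsL a' t L Y) →
      ∀ ρ : ℝ, 0 < ρ → DenseCharge ρ Y → ∃ κ : ℝ, 0 < κ ∧ StrainedCubes κ Y

/-- **(B) `SparseChargeRelax T₀ D`** — RELAX restricted to textures with SPARSE CHARGE (the elastic regime).  KERNEL-WEAKER than RELAX. -/
def SparseChargeRelax (T₀ D : ℝ) : Prop :=
  ∀ Y : Set (EuclideanSpace ℝ (Fin 3)), CleanClass T₀ D Y → ∀ t : ℝ, 0 < t → ∀ L : ℝ,
    (∀ a' : ℝ, 47 / 50 ≤ a' → a' ≤ 1 → ViolatorsL a' t L Y) → SparseCharge Y → ∃ κ : ℝ, 0 < κ ∧ StrainedCubes κ Y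

/-- **The local relaxation test `LocalRelaxationTest T₀ D`** (TRUE-type, typed): a texture of the recurrent clean class that is NOT locally
optimal has strained cubes.  Mechanism: an improving surgery `(F, G)` with gain `g > 0`; by uniform recurrence `ε`-copies of the patch recur
with bounded gaps and (finite sums continuous, tails `O(R⁻³)` by `abs_tsum_lennardJones_le_dyadic`) keep gain `≥ g/2`; in a cube of side `ℓ`
perform the surgeries on an `R'`-separated subfamily of `≍ (ℓ/R')³` interior copies simultaneously — cross terms `O(R'⁻⁶)` per pair of
patches and boundary tails are absorbed — a competitor with the same number of atoms and energy lower by `(g/4)(ℓ/R')³`. -/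
def LocalRelaxationTest (T₀ D : ℝ) : Prop :=
  ∀ Y : Set (EuclideanSpace ℝ (Fin 3)), CleanClass T₀ D Y → ¬ LocallyOptimal Y → ∃ κ : ℝ, 0 < κ ∧ StrainedCubes κ Y

/-- **The residual «ElasticLiouville» `ElasticLiouvilleLaw T₀ D`**: a texture of the recurrent clean class with SPARSE CHARGE that is LOCALLY
OPTIMAL and VIRIAL-BALANCED and nevertheless `(t, L)`-strained at every admissible scale has strained cubes.  KERNEL-WEAKER than
`SparseChargeRelax` (two added hypotheses), hence than RELAX.  Conjecturally VACUOUSLY true: the hypotheses force a uniformly scaled Barlow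
stacking at virial balance (every site a `1 %`-cuboctahedral/anticuboctahedral shell ⇒ the displacement from a layered reference is within `1 %`
of conformal; local optimality ⇒ the discrete elastostatic system holds exactly; bounded strain + zero mean pressure ⇒ homogeneous by the
Liouville property of the linearised lattice system and smallness of the window), and a uniformly scaled Barlow stacking is not strained. -/
def ElasticLiouvilleLaw (T₀ D : ℝ) : Prop :=
  ∀ Y : Set (EuclideanSpace ℝ (Fin 3)), CleanClass T₀ D Y → SparseCharge Y → LocallyOptimal Y → VirialBalanced Y →
    ∀ t : ℝ, 0 < t → ∀ L : ℝ, (∀ a' : ℝ, 47 / 50 ≤ a' → a' ≤ 1 → ViolatorsL a' t L Y) → ∃ κ : ℝ, 0 < κ ∧ StrainedCubes κ Y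

/-! ## §5  Logic of the split (the energetic inputs are supplied in `…Dilation` and `…Pricing`) -/

/-- RELAX from the two charge branches (exhaustive case split on `∃ ρ > 0, DenseCharge ρ Y`). [this file] -/
theorem edgeRelaxationLaw_of_chargeSplit {T₀ D : ℝ} (hA : ChargeDensityRelax T₀ D) (hB : SparseChargeRelax T₀ D) :
    EdgeRelaxationLaw T₀ D := by
  intro Y hY t ht L hV
  by_cases h : ∃ ρ : ℝ, 0 < ρ ∧ DenseCharge ρ Y
  · obtain ⟨ρ, hρ, hd⟩ := h
    exact hA Y hY t ht L hV ρ hρ hd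
  · push Not at h
    exact hB Y hY t ht L hV (fun ρ hρ => h ρ hρ)

/-- The sparse branch from the three tests, the dilation test entering as the hypothesis `hD` (discharged by
`…Dilation.strainedCubes_of_dilationStrained`). [this file] -/
theorem sparseChargeRelax_of_tests' {T₀ D : ℝ}
    (hD : ∀ (κ : ℝ) (Y : Set (EuclideanSpace ℝ (Fin 3))), DilationStrainedCubes κ Y → StrainedCubes κ Y)
    (hL : LocalRelaxationTest T₀ D) (hE : ElasticLiouvilleLaw T₀ D) : SparseChargeRelax T₀ D := by
  intro Y hY t ht L hV hS
  by_cases hP : ∃ κ : ℝ, 0 < κ ∧ DilationStrainedCubes κ Y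
  · obtain ⟨κ, hκ, hd⟩ := hP
    exact ⟨κ, hκ, hD κ Y hd⟩
  · push Not at hP
    by_cases hO : LocallyOptimal Y
    · exact hE Y hY hS hO (fun κ hκ => hP κ hκ) t ht L hV
    · exact hL Y hY hO

/-! ### Kernel-weaker certificates: every branch is RELAX restricted to a subclass -/

/-- RELAX implies branch (A). [this file] -/
theorem chargeDensityRelax_of_edgeRelaxationLaw {T₀ D : ℝ} (h : EdgeRelaxationLaw T₀ D) : ChargeDensityRelax T₀ D :=
  fun Y hY t ht L hV _ _ _ => h Y hY t ht L hV

/-- RELAX implies branch (B). [this file] -/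
theorem sparseChargeRelax_of_edgeRelaxationLaw {T₀ D : ℝ} (h : EdgeRelaxationLaw T₀ D) : SparseChargeRelax T₀ D :=
  fun Y hY t ht L hV _ => h Y hY t ht L hV

/-- Branch (B) implies the residual. [this file] -/
theorem elasticLiouvilleLaw_of_sparseChargeRelax {T₀ D : ℝ} (h : SparseChargeRelax T₀ D) : ElasticLiouvilleLaw T₀ D :=
  fun Y hY hS _ _ t ht L hV => h Y hY t ht L hV hS

/-- RELAX implies the residual. [this file] -/
theorem elasticLiouvilleLaw_of_edgeRelaxationLaw {T₀ D : ℝ} (h : EdgeRelaxationLaw T₀ D) : ElasticLiouvilleLaw T₀ D :=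
  elasticLiouvilleLaw_of_sparseChargeRelax (sparseChargeRelax_of_edgeRelaxationLaw h)

/-! ### Elementary facts on the currencies -/

/-- `S_k ≥ 0`. [this file] -/
theorem invPowSum_nonneg (k : ℕ) (F : Finset (EuclideanSpace ℝ (Fin 3))) : 0 ≤ invPowSum k F :=
  Finset.sum_nonneg fun _ _ => Finset.sum_nonneg fun _ _ => pow_nonneg (inv_nonneg.2 dist_nonneg) _

/-- The dilation gain is nonnegative. [this file] -/
theorem dilationGain_nonneg (F : Finset (EuclideanSpace ℝ (Fin 3))) : 0 ≤ dilationGain F :=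
  div_nonneg (sq_nonneg _) (mul_nonneg (by norm_num) (invPowSum_nonneg 12 F))

/-- `DilationStrainedCubes` is monotone in the rate. [this file] -/
theorem dilationStrainedCubes_mono {κ κ' : ℝ} {Y : Set (EuclideanSpace ℝ (Fin 3))} (hκ : κ' ≤ κ)
    (h : DilationStrainedCubes κ Y) : DilationStrainedCubes κ' Y := by
  intro ℓ₀
  obtain ⟨ℓ, hℓ, c, F, hF, hle⟩ := h (max ℓ₀ 0)
  refine ⟨ℓ, (le_max_left _ _).trans hℓ, c, F, hF, le_trans ?_ hle⟩
  have hℓ0 : 0 ≤ ℓ := (le_max_right _ _).trans hℓ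
  exact mul_le_mul_of_nonneg_right hκ (pow_nonneg hℓ0 3)

/-- `DenseCharge` is monotone in the density. [this file] -/
theorem denseCharge_mono {ρ ρ' : ℝ} {Y : Set (EuclideanSpace ℝ (Fin 3))} (hρ : ρ' ≤ ρ) (h : DenseCharge ρ Y) :
    DenseCharge ρ' Y := by
  intro ℓ₀
  obtain ⟨ℓ, hℓ, c, N, y, hy, hr, hle⟩ := h (max ℓ₀ 0)
  refine ⟨ℓ, (le_max_left _ _).trans hℓ, c, N, y, hy, hr, le_trans ?_ hle⟩
  have hℓ0 : 0 ≤ ℓ := (le_max_right _ _).trans hℓ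
  exact mul_le_mul_of_nonneg_right hρ (pow_nonneg hℓ0 3)

/-- The trivial surgery releases nothing: `surgeryGain Y F F = 0`. [this file] -/
theorem surgeryGain_self (Y : Set (EuclideanSpace ℝ (Fin 3))) (F : Finset (EuclideanSpace ℝ (Fin 3))) :
    surgeryGain Y F F = 0 := by
  unfold surgeryGain
  ring

end Summit.AtomisticToContinuum.Crystallization.Theorems.OverbindingBudgetElasticSplitStatements
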